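import Summits.CriticalPhenomena.CardyFormulaZ2.Theses.CardyIKTransport
import Summits.CriticalPhenomena.CardyFormulaZ2.Theses.CardyDiluteOrbit
import Literature.Probability.RandomPlanarGeometry.ConformalRectangleProofs

/-!
# The crux `CardyIKTransport.CornerLineDescent` (stmt-CriticalPhenomena-10964) and the sibling crux
# `CardyDiluteOrbit.IKBondBridge` (stmt-CriticalPhenomena-5914): the item-level implications, landed

Support file (`--supports stmt-CriticalPhenomena-10964`, registered names `cornerLineDescent_of_ikBondBridge`,
`ikBondBridge_of_cardyIK_of_cornerLineDescent`, `cornerLineDescent_iff_ikBondBridge_of_cardyIK`).  These three short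
theorems are the §A bookkeeping of the crux disprover's workfile `Cruxes/CornerLineDescent/Disproof.lean`
(cdisprove cycle 1, 2026-08-16), moved into the importable tree so that the planner's dependency graph can cite them:

* `cornerLineDescent_of_ikBondBridge`: the sibling route's crux `IKBondBridge` (stmt-5914: the crude isotropic
  Izergin–Korepin crossing probability and the crude standard bond-`ℤ²` crossing probability of every conformal rectangle
  differ by `o(1)` as `δ → 0⁺`) implies this route's crux `CornerLineDescent` (stmt-10964: Cardy for the IK gauge in every
  conformal rectangle ⇒ Cardy for crude bond-`ℤ²`) — limits transfer along a vanishing difference; the antecedent of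
  `CornerLineDescent` is character-for-character `CardyDiluteOrbit.CardyIK` (stmt-5913);
* `ikBondBridge_of_cardyIK_of_cornerLineDescent`: conversely, under `CardyIK` the crux gives the bridge (uniformizing data
  exist for every conformal rectangle, `MarkedDomain.exists_isUniformizing_holds`);
* `cornerLineDescent_iff_ikBondBridge_of_cardyIK`: so under `CardyIK` the two cruxes are EQUIVALENT — pooled provers attack
  one statement, and a proof or a conjecture-filing of either closes the other conditionally.

Together with `Theorems/CardyIKTransportCornerLineDescentOfInfluenceBounds.lean` (the line `symmetric-seed-second-order`:
`CornerLineDescent` modulo its two registered influence stubs) this records both conditional closures of stmt-10964 in the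
tree.  No new mathematics.
References: `Cruxes/CornerLineDescent/Disproof.lean` §A; route files `Theses/CardyIKTransport.lean` (item 10964),
`Theses/CardyDiluteOrbit.lean` (items 5913, 5914).
-/

noncomputable section

namespace Summit.CriticalPhenomena.CardyFormulaZ2.Theorems.CornerLineDescent

open Filter Topology
open Literature.Probability.RandomPlanarGeometry
open Summit.CriticalPhenomena.CardyFormulaZ2.Theses

/-- The sibling crux `IKBondBridge` (stmt-CriticalPhenomena-5914: crude IK and crude standard bond-`ℤ²` crossing
probabilities differ by `o(1)`, every conformal rectangle) implies the crux `CornerLineDescent`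
(stmt-CriticalPhenomena-10964): Cardy limits transfer along a vanishing difference.  (Disproof §A,
`cornerLineDescent_of_ikBondBridge`, cdisprove cycle 1.) [folklore] -/
theorem cornerLineDescent_of_ikBondBridge :
    Summit.CriticalPhenomena.CardyFormulaZ2.Theses.CardyDiluteOrbit.IKBondBridge →
      Summit.CriticalPhenomena.CardyFormulaZ2.Theses.CardyIKTransport.CornerLineDescent := by
  intro h hIK R φ x hφx
  have h1 := hIK R φ x hφx
  have h2 := h R
  have h3 := h1.sub h2
  simpa using h3

/-- Conversely, Cardy for the IK gauge (`CardyIK`, stmt-CriticalPhenomena-5913) and the crux `CornerLineDescent` give the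
`o(1)` bridge `IKBondBridge`: both families then have the Cardy limit of the common modulus, read off any uniformizing datum
(`MarkedDomain.exists_isUniformizing_holds`).  (Disproof §A, `ikBondBridge_of_cardyIK_of_crudeBondCardy`.) [folklore] -/
theorem ikBondBridge_of_cardyIK_of_cornerLineDescent :
    Summit.CriticalPhenomena.CardyFormulaZ2.Theses.CardyDiluteOrbit.CardyIK →
      Summit.CriticalPhenomena.CardyFormulaZ2.Theses.CardyIKTransport.CornerLineDescent →
        Summit.CriticalPhenomena.CardyFormulaZ2.Theses.CardyDiluteOrbit.IKBondBridge := by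
  intro hIK hdesc R
  obtain ⟨φ, x, hφx⟩ := MarkedDomain.exists_isUniformizing_holds R
  have h1 := hIK R φ x hφx
  have h2 := hdesc hIK R φ x hφx
  have h3 := h1.sub h2
  simpa using h3

/-- Under `CardyIK` (stmt-CriticalPhenomena-5913) the two sibling cruxes `CornerLineDescent` (stmt-10964) and
`IKBondBridge` (stmt-5914) are equivalent.  (Disproof §A, `cornerLineDescent_iff_ikBondBridge`.) [folklore] -/
theorem cornerLineDescent_iff_ikBondBridge_of_cardyIK :
    Summit.CriticalPhenomena.CardyFormulaZ2.Theses.CardyDiluteOrbit.CardyIK →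
      (Summit.CriticalPhenomena.CardyFormulaZ2.Theses.CardyIKTransport.CornerLineDescent ↔
        Summit.CriticalPhenomena.CardyFormulaZ2.Theses.CardyDiluteOrbit.IKBondBridge) :=
  fun hIK => ⟨ikBondBridge_of_cardyIK_of_cornerLineDescent hIK, cornerLineDescent_of_ikBondBridge⟩

end Summit.CriticalPhenomena.CardyFormulaZ2.Theorems.CornerLineDescent
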